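import Mathlib
import HarnessLib
import HarnessLib.Audit
import Summits.AtomisticToContinuum.Statement
import HarnessLib.Audit.Status.Attr

/-!
Route: CompensatedSlabClusters

DORMANT since 2026-08-23T23:13:19Z (reconciler: no traction for 6.3 d (last activity item-evidence-added at 2026-08-17T14:48:49Z); parked, not closed — `ledger route dormant route-AtomisticToContinuum-CompensatedSlabClusters --off` to r) — unstaffed, not closed; items shared with open routes are served there. `ledger route dormant <id> --off` reactivates.

# Route CompensatedSlabClusters — Serre's compensated integrability per momentary cluster gives
collisional-flux tightness at fixed density

X = X_R ∧ X_C ("it suffices to show"), realising card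
serre-compensated-integrability-cluster-payload (spine; an A-PRIORI MODULE plus
its bridge). X_R (CollisionPayloadTight, the card's (R) in tightness form): under the local Gibbs
law and the deterministic hard-sphere
flow at fixed reduced density σ < σ₀, the total collisional payload Σ_(collisions in [0,T]) Σ_i
|v_i(t) − v_i(t⁻)| is O_P((N+1)^(4/3)),
i.e. O(1) momentum exchange per particle per interparticle-crossing time — exactly the extensivity
of the collisional stress that every
flux-level closure needs and that no entropy or virial argument gives on 𝕋³. X_R is obtained as
SerrePeriodicPayload (Serre's torus
compensated-integrability bound, the imported unproved fact, filed FIRST) + ClusterFourthMoment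
(fourth moment of momentary-cluster
sizes per kinetic slab under the non-equilibrium law) via the glue PayloadOfClusters. X_C
(PayloadClosure): given X_R, the shared
mean-square waypoint L2HydroFields follows (weak flux closure); then Chebyshev–Markov, PROVED inside
the deciding theorem, to the packing-guarded conjunct `_root_.HydrodynamicLimit` (statement re-type
2026-08-16, p126922: the module proves the UNGUARDED mean-square limit, so the guard hypothesis is
not used and η₀ := 1).
Lean: `CollisionPayloadTight ∧ (CollisionPayloadTight → L2HydroFields)`

## Assembly
Pure logic plus Chebyshev: PayloadOfClusters turns SerrePeriodicPayload and ClusterFourthMoment into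
CollisionPayloadTight; PayloadClosure gives the
mean-square convergence of the three empirical fields at every t < T (the body of L2HydroFields,
unguarded); Chebyshev–Markov in ℝ≥0∞
(meas_ge_le_lintegral_div; measurability of the tested empirical fields from empiricalMeasure =
N⁻¹Σδ) gives convergence in probability, i.e. the
conjunct `_root_.HydrodynamicLimit` BY NAME with η₀ := 1 (the packing guard of the re-typed conjunct
is discarded — the module proves more).
Deciding theorem (glue2.lean, rendered verbatim by the gate; CRUX-ONLY since rev 7, 2026-08-16):
`theorem closes (h₁ : SerrePeriodicPayload)
(h₂ : ClusterFourthMoment) (h₃ : PayloadOfClusters) (h₄ : PayloadClosure) :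
_root_.HydrodynamicLimit` — `have hL2 := h₄ (h₃ h₁ h₂)`, then the
Chebyshev step formerly assumed as the support item L2ToHydroLimit is PROVED in place (≈ 90 lines,
sorry-free, lean check rc 0, axioms
propext/Classical.choice/Quot.sound); L2ToHydroLimit is dropped as an item. History: rev ≤ 5 `closes
: … → PayloadClosure → L2ToHydroLimit →
_root_.HydrodynamicLimit := fun h₁ h₂ h₃ h₄ h₅ => h₅ (h₄ (h₃ h₁ h₂))` against the old abbrev; rev 6
the same post-composed with
HydrodynamicLimit.of_unguarded (flagged glue.non-crux-hypothesis). This route re-opens, in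
conforming form, the line of the retired record
route-AtomisticToContinuum-CompensatedClusterPayload (not-a-thesis audit 2026-08-15: its assembly
named the Literature constant).

Rationale: WHY THIS LINE. Serre's Compensated Integrability (Serre2019; graph-supported version with
determinantal masses, Serre2021 §4; torus version Serre2024
Thm 3/11) turns "mass and momentum are conserved and the mass–momentum tensor is positive
semi-definite" into an a-priori bound on how much
momentum N balls can exchange: Σ_kinks (v̄|δv| + |v∧v′|) ≤ c_n N² v̄² in ℝⁿ (Serre2021 Thm 1.1, slab
form in §5) and Σ_coll |[v]| ≤
C_d N² v̄ (1 + v̄T/L) on (0,T)×L𝕋^d under the linear-density hypothesis N a < κ_d L (Serre2024 Thm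
6, (19)–(20)) — worst-case sharp (beams),
hence N^(2/3) too weak for the gas and, at fixed reduced density (N a/L = σN^(2/3)/2), not even
applicable to it. The line applies the torus
theorem where its hypothesis holds for free: to each MOMENTARY CLUSTER (Sinai's Δ-cluster,
Sinai1972, DobrushinSinaiSukhov1989,
GabrielovEtAl2008) of ONE kinetic slab of duration (N+1)^(-1/3), an isolated K-ball periodic motion
with Kε < κ as soon as
K < κ(N+1)^(1/3)/σ, whose payload is then ≤ c(K^(3/2)E_K^(1/2) + τ K E_K): polynomial in K, blind to
gaps, cages and contact angles;
Cauchy–Schwarz over clusters and Markov over the T(N+1)^(1/3) slabs reduce (R) to ONE statistic of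
who-touches-whom in a slab, the
fourth moment Σ_i K_i⁴ = O(N) (fourth, not second, so that giant clusters K ≥ κN^(1/3)/σ, where the
torus hypothesis fails, are excluded
by a union bound). Imported areas: a-priori estimates for divergence-controlled positive tensors
(hyperbolic PDE / Alexandrov–Monge–Ampère
geometry) and dynamical-cluster (percolation-in-time) statistics of gases; no entropy, no closure,
no expansion in σ. None of the seven
open routes (RelEntropyErgodic, VanishingNoise, ChaoticMixing, DenseKineticExpansion,
DissipativeWeakStrong, ImplosionLoophole,
OneParticleInfluence) has an a-priori estimate on collisional transfer; DissipativeWeakStrong's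
informal FluxClosure (0823) presupposes
exactly this tightness. Negatives index empty at filing.

RANKED CRUXES. #2 SerrePeriodicPayload (crux; retriaged support 2026-08-15, re-kinded crux
2026-08-16 because it is a load-bearing unproved hypothesis of the crux-only `closes` — to be
vendored as the Literature fact SerrePeriodicPayloadBound and then discharged) — SERRE'S PERIODIC
PAYLOAD BOUND (imported published fact, filed FIRST per the plancard rule; card S2's engine): there
are universal κ > 0 and c such that for every K, every diameter ε > 0 with Kε < κ, every hard-sphere
trajectory γ of K spheres on 𝕋³ (IsHardSphereTrajectory, torus geometry) and every a ≤ b, the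
payload Σ_(collision times t ∈ [a,b]) Σ_i ‖v_i(t) − v_i(t⁻)‖ (right-continuous velocities, left
limits) is ≤ c (K^(3/2) E^(1/2) + (b − a) K E), E = configEnergy (γ a) = ½Σ|v_i|². Transcription of
Serre2024 Thm 6 / (19)–(20) (Σ_coll |[v]| ≲_d N (NE)^(1/2) + N E T/L under N a < θ(d) L) to the unit
torus, both kinks of a collision counted; the ℝ³ analogue is Serre2021 Thm 1.1 (slab form, §5). To
be vendored as a Literature named fact and then consumed as a hypothesis; a Lean proof needs the CI
theory (Serre2019; Serre2024 Thm 3, Thm 11; determinantal masses Serre2021 §4). [difficulty: XL]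
(why it might fail: Published theorem; risks are formal: transcription (unit torus vs L𝕋³ constants,
factor 2 for kinks, collisions exactly at a or b, K ≤ 1) and whether IsHardSphereTrajectory matches
Serre's genericity (binary, locally finite: it does); proving it in Lean means formalising CI
itself.) [Serre2024, Serre2021, Serre2019, Serre2022, arXiv:2409.12511]
#3 ClusterFourthMoment (crux) — FOURTH MOMENT OF MOMENTARY CLUSTERS (card S1 folded with its chain
counting into one typed statistic): for all continuous profiles a₀, θ₀ > 0, u₀ there is σ₀ such that
for σ < σ₀ and every T > 0 there is C with: for all N, all flows Φ of N+1 spheres of diameter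
σ(N+1)^(-1/3), all kinetic slabs [s, s+τ_N] ⊂ [0,T], τ_N = (N+1)^(-1/3): E_(localGibbsLaw) Σ_i
K_i(s)⁴ ≤ C(N+1), where K_i(s) is the size of the connected component of i in the slab collision
graph (i ~ j iff i, j are in contact at some t ∈ [s, s+τ_N] along the orbit). Heuristics: mean slab
degree ≈ 4√(πθ)ρσ² ≪ 1 for σ small, so the exploration of a cluster is dominated by a subcritical
branching process and all moments are O(1) per particle; the fourth moment (not the second) is what
excludes giant clusters K ≥ κ(N+1)^(1/3)/σ over T(N+1)^(1/3) slabs by a union bound (Σ_i K_i⁴ ≥ K⁵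
on a cluster of size K). [difficulty: open-problem] (why it might fail: Subcritical only while the
local slab degree ≈ 4√(πθ)ρσ² < 1: dynamically formed hot/dense regions, or a pre-shock implosion
(route ImplosionLoophole's DenseExcursion — σ₀ is fixed before T) make the slab graph percolate; one
giant momentary cluster K ≍ N^a, a > 1/5, already breaks Σ_i K_i⁴ = O(N).) [GabrielovEtAl2008,
Sinai1972, DobrushinSinaiSukhov1989, Alexander1975, Spohn1991]
#4 PayloadClosure (crux) — CLOSURE GIVEN THE A-PRIORI BOUND (the bridge from the module to the
conjunct): CollisionPayloadTight → L2HydroFields, filed SELF-CONTAINED (both Props inlined —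
definitionally the same implication, Iff.rfl — because the gate emits cruxes before the support
decls it names). With the collisional momentum/energy transfer tight, the empirical flux measures on
[0,T)×𝕋³ are tight; the intended proof identifies limit points as dissipative measure-valued
hs-Euler solutions and closes by relative-energy weak–strong uniqueness before the first shock (the
FluxClosure/EntropyAdmissibility/WSU programme of route DissipativeWeakStrong, items 0823–0825), or
by any other closure engine that consumes (R). [deps: CollisionPayloadTight] [difficulty:
open-problem] (why it might fail: It is the closure problem given one a-priori bound: tight
collisional fluxes still allow non-Dirac Young-measure limits (persistent velocity anisotropy,
oscillation/concentration defects), and weak–strong uniqueness needs an entropy inequality that (R)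
does not supply.) [BrezinaFeireisl2018, OllaVaradhanYau1993, Spohn1991, arXiv:1503.05246]
#9 CollisionPayloadTight (support) — THE MODULE'S DELIVERABLE (card (R), tightness form; direct
proofs welcome at low priority, otherwise via PayloadOfClusters): for all continuous profiles ∃ σ₀ ∀
σ < σ₀ ∀ T > 0 ∀ η > 0 ∃ C ∀ N ∀ Φ: localGibbsLaw{ z | C (N+1)^(4/3) < Σ_(collision times t ∈ [0,T]
of the orbit of z) Σ_i ‖v_i(t) − v_i(t⁻)‖ } ≤ η. Scale: ≍ 4√(πθ)σ² collisions per particle per slab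
(N+1)^(-1/3), each exchanging O(√θ), over T(N+1)^(1/3) slabs. In probability rather than in mean
because on 𝕋³ at fixed reduced density no deterministic bound makes the payload integrable
(Serre2024's linear-density hypothesis fails for the whole gas). Consumers: FluxClosure tightness
half (0823), MeanCollisionalPressureBound of card apriori-tails-and-rattlers, K-inputs of
stiff-relaxation-collisional-coercivity. [difficulty: open-problem] [Serre2021, Serre2024,
Spohn1991]
#5 PayloadOfClusters (crux since rev 7, 2026-08-16; ledger rank 9) — GLUE LEMMA (card S3):
SerrePeriodicPayload → ClusterFourthMoment → CollisionPayloadTight, a hypothesis of `closes` and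
therefore a crux under the crux-only definition of a route until it is proved (why it might fail:
a.e. splicing of momentary-cluster slab pieces into global K-sphere IsHardSphereTrajectory's off a
null set of the (N+1)-body law, collisions at slab endpoints, and E_tot = O(N), Σ_k(Σ_i K_i²)^(1/2)
= O(T N^(5/6)) only in probability — the 4/3 exponent has no slack). Proof plan: (i) for P-a.e. z
each connected component A (|A| = K) of the slab graph is isolated during the slab, and its
sub-configuration is a piece of a K-sphere torus trajectory, extendable to a global
IsHardSphereTrajectory for a.e. z (K-particle flows exist: HardSphereFlow.nonempty_torus_holds;
cylinders over Liouville_K-null sets are null; localGibbsLaw ≪ Liouville); (ii) on the event that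
all clusters of all slabs [kτ_N,(k+1)τ_N] ⊂ [0,T] have K < κ(N+1)^(1/3)/σ (probability ≥ 1 −
CTσ⁵κ⁻⁵(N+1)^(-1/3) by the fourth moment, Markov and a union bound) apply the fact cluster-wise:
pay(slab) ≤ c[(Σ_i K_i²)^(1/2)(E_tot)^(1/2) + (κ/σ)E_tot] (Cauchy–Schwarz; clusters of one slab are
particle-disjoint; energy conserved); (iii) E_tot ≤ C₂(N+1) with probability ≥ 1 − η/3 (Gaussian
velocities of the canonical law) and Markov on Σ_k(Σ_i K_i(kτ_N)²)^(1/2), whose mean is ≤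
(T(N+1)^(1/3)+1)(C(N+1))^(1/2), give pay(0,T) ≤ C_η(N+1)^(4/3) with probability ≥ 1 − η; small N by
tightness of each law. [difficulty: L] [Serre2024, Alexander1975, GST2013, CIP1994]
#9 EquilibriumClusterMoment (crux — auto-promoted 2026-08-16 as conjecture-grade; not a hypothesis
of closes, the provers' first foothold) — GLOBAL-EQUILIBRIUM CASE of ClusterFourthMoment (constant
profiles c₀, uc, θc; the canonical law is flow-invariant, HomogeneousInvariance item 3073, so the
bound is uniform over all slabs s ∈ ℝ): ∃ σ₀ ∀ σ < σ₀ ∃ C ∀ N Φ s: E Σ_i K_i(s)⁴ ≤ C(N+1). The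
quantitative form of Sinai's cluster dynamics (existence and finiteness of Δ-clusters at low density
for short windows, Sinai1972 and its multidimensional extension reported in
DobrushinSinaiSukhov1989; numerics GabrielovEtAl2008: exponential cluster-size law for Δ below t_c ≈
0.4ρ⁻¹): Palm/GNZ bounds for the canonical hard-sphere gas plus domination of the slab exploration
by a subcritical branching process with Maxwellian marks. First foothold for provers; the MD check
for refuters; the equilibrium half of card S4 (Serre's printed open problem for Gibbs-typical data
then follows with PayloadOfClusters). [difficulty: L] [Sinai1972, DobrushinSinaiSukhov1989,
GabrielovEtAl2008, Alexander1975]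
#9 L2HydroFields (support) — SHARED TYPED WAYPOINT (item stmt-AtomisticToContinuum-0800 verbatim;
target of routes DenseKineticExpansion, DissipativeWeakStrong, OneParticleInfluence): mean-square
convergence of the three empirical fields at every t < T under the local Gibbs law; here the
codomain of PayloadClosure. [difficulty: open-problem] [Spohn1991, OllaVaradhanYau1993]
(dropped rev 7) L2ToHydroLimit — the shared provable-now step L2HydroFields → HydrodynamicLimit
(Markov/Chebyshev in ℝ≥0∞, meas_ge_le_lintegral_div, and squeeze) is now PROVED INSIDE `closes`
against the re-typed packing-guarded conjunct (η₀ := 1, guard discarded) and is no longer an item of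
this route. [OllaVaradhanYau1993]

TWO-LAYER PLAN. Foreseen glued splits (k ≤ 3, depth 1), filed only when a crux closes or stalls:
ClusterFourthMoment ⇐ ConditionalSlabRate (card S1: given the
slab past and "j is hit at s′", the expected number of further slab-collisions of j is ≤ Cσ², under
f_t up to T — needs conditional
expectation w.r.t. the flow filtration) → SubcriticalExploration (rate bound ⇒ fourth moment by
chain counting) → ClusterFourthMoment;
PayloadOfClusters ⇐ ClusterSplicing (momentary cluster = a.s.-extendable K-trajectory piece) →
SlabBookkeeping (Cauchy–Schwarz/Markov) →
PayloadOfClusters; PayloadClosure ⇐ FluxTightness (from CollisionPayloadTight, provable) →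
DissipativeMvLimit (0823/0824 typed) →
PayloadClosure (with WSU 0825). EquilibriumClusterMoment is the s-independent special case provers
should take first.

KILL CRITERIA. ClusterFourthMoment refuted AT EVERY SLAB SCALE (giant momentary clusters of size ≥
(N+1)^(1/5+) with non-vanishing probability before T
under some local Gibbs data for all small σ) closes the route `refuted:ClusterFourthMoment`; refuted
only at τ_N = (N+1)^(-1/3) ⇒ pivot:
restate with slabs λ(N+1)^(-1/3), λ = λ(profiles) small (payload is additive over sub-slabs, the
glue is unchanged). CollisionPayloadTight
refuted directly (payload super-extensive in probability) kills the CI placement outright — close,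
and record that collisional stress is
not tight at fixed density (this would also break FluxClosure 0823). A formal counterexample to
SerrePeriodicPayload can only be a
mis-transcription of Serre2024 Thm 6 — restate, do not close. PayloadClosure refuted (¬L2HydroFields
while (R) holds) closes the route
but leaves the module (CollisionPayloadTight, EquilibriumClusterMoment) as Literature-side facts
wanted by other cards. L2HydroFields
proved elsewhere moots PayloadClosure and the route (superseded).

NOT DECOMPOSED YET. STATEMENT RE-TYPE 2026-08-16 (packing guard ρσ³ < η₀ on the Euler solution,
p126922): this route proves the unguarded mean-square limit and discards the guard; the natural
weaker bridge PayloadClosureInBand : CollisionPayloadTight → (∃ η₀ > 0, mean-square convergence for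
guarded solutions only) — exactly the regime in which the relative-energy weak–strong argument has a
smooth strictly convex hs equation of state — is deliberately NOT filed yet (it would supersede
PayloadClosure; tenure move if PayloadClosure stalls or is attacked through the unguarded typing).
The conditional slab-rate statement (card S1; needs `MeasureTheory.condexp` w.r.t. the σ-algebras
generated by the flow on [s, s′] —
deferred until ClusterFourthMoment is taken); the limit-tensor structure (card S5: torus CI for weak
limits of particle mass–momentum
tensors ⇒ ∫∫(det 𝒯_ac)^(1/3) ≤ C and rank-deficient concentration defects — needs a
`DivFreePSDTensorMeasure` notion, tenure work
attached to DissipativeWeakStrong); velocity tails (T) (card apriori-tails-and-rattlers, not this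
mechanism); the constants κ, c of
Serre2024 on the unit torus; the choice λ of the slab length; the FluxTightness child of
PayloadClosure.

CHEAPEST FALSIFIER. (i) Event-driven MD (kit): N+1 ∈ {10³, 10⁴, 10⁵}, σ ∈ {0.2, 0.4}, θ = 1,
equilibrium and a local-Gibbs shear + compression profile;
per slab τ_N record Σ_i K_i⁴/(N+1) for t ≤ T = 1 and pay(0,T)/(N+1)^(4/3): growth with N of either,
or a power-law slab-cluster tail,
kills ClusterFourthMoment as stated (then try slabs λτ_N). (ii) LOOKUP DONE this session:
GabrielovEtAl2008 (2-D elastic billiard,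
10 ≤ N ≤ 10⁴, densities 10⁻⁷–10⁻¹, read pp. 4–8): Δ-cluster masses follow a tapered law
M^(−β)e^(−M/γ(Δ)), essentially exponential
for windows Δ ≪ t_c ≈ 0.4ρ⁻¹ and a pure power law β ≈ 5/2 only at t_c, maximal cluster ∝ log N below
t_c/3 (their (5),(6),(10)); the
kinetic slab sits at Δ/t_c = O(σ²) — consistent with the crux in equilibrium, says nothing out of
equilibrium. (iii) Paper check of
the transcription of Serre2024 Thm 6 (torus period, kinks vs collisions): only constants move (∃κ ∃c
absorbs them).

NUMBERS. Needed: Σ_(unit time)|δv| = O((N+1)^(4/3)) (collisional pressure O(1): ε_N Σ|δv|/(N+1) per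
unit time ≍ σ³). Known deterministic bounds:
Σ_kinks(v̄|δv| + |v∧v′|) ≤ c_n N² v̄² in ℝⁿ, sharp for beams (Serre2021 Thm 1.1, (4)); Σ_coll|[v]| ≤
C_d N² v̄(1 + v̄T/L) on (0,T)×L𝕋^d iff
N a < κ_d L (Serre2024 Thm 6 (7); (19)–(20): ≲_d N(NE)^(1/2) + NET/L); at fixed reduced density N
a/L = σN^(2/3)/2 → ∞, so only clusters
with K < κ(N+1)^(1/3)/σ qualify. Collision count of an isolated K-cluster ≤ (32K^(3/2))^(K²)
(BuragoFerlegerKononenko1998) — why moments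
need CI. Slab statistics: expected collisions per particle per slab ≈ 4√(πθ)ρσ² (Boltzmann rate ×
τ_N; 0.64 at σ = 0.3, θ = ρ = 1);
GabrielovEtAl2008: t_c ≈ 0.4ρ⁻¹, β ≈ 5/2 at t_c, exponential below. Union bound for giant clusters
needs the p-th moment with p > 3
(T(N+1)^(4/3−(p+1)/3) → 0): p = 4 chosen. Items at open: 9 (3 cruxes, 5 support, 1 assembly) + the
deciding theorem `closes` (after the re-type repair, rev 7: 8 items — cruxes SerrePeriodicPayload,
ClusterFourthMoment, PayloadClosure, PayloadOfClusters, EquilibriumClusterMoment[auto]; supports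
CollisionPayloadTight, L2HydroFields; Assembly — and a crux-only `closes` with 4 binders); no Target
block (the gate emits it before the decls it would name; X is the thesis Lean line).

DEFINITION REQUESTS. (1) CITE/FACT wanted (filed after open as `--kind cite`): Literature named fact
`SerrePeriodicPayloadBound` in
Literature/MathematicalPhysics/KineticTheory (or Analysis/FluidPDE next to HardSphereDynamics) with
cite tag Serre2024 Thm 6 — once landed,
downstream items are restated with `(h : Fact) →` and crux 2 becomes that fact. (2) DEFINITION
wanted: `collisionPayload G ε γ a b :=
∑ᶠ t ∈ collisionTimes G ε γ ∩ Icc a b, ∑ i, ‖(γ t i).2 − (Function.leftLim γ t i).2‖` and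
`slabClusterSize` (connected component of the
slab contact graph) in Literature/Analysis/FluidPDE, shared with cards apriori-tails-and-rattlers,
contact-traces-are-bulk,
relay-race-light-cone (today inlined via `let`/finsum in every signature).

Novelty: Searches (2026-08-15): `lit search --source crossref "compensated integrability hard spheres
collisions Serre"` (12: Serre 2019/2021/2022/2024 + survey doi:10.1007/978-3-031-55260-1_4; nothing
cluster-wise or in the mean); `lit search --source crossref "Sinai construction of cluster dynamics
…"` (8: Sinai1972 doi:10.1007/bf01028564, DobrushinSinaiSukhov1989, GabrielovEtAl2008
doi:10.4171/057-1/13 — READ pp. 3–9); `lit vsearch "infinite system splits into finite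
non-interacting clusters …" --problem` (10 book hits, none joining clusters to CI); `lit frontier
AtomisticToContinuum --since 2020` (30 rows, no CI); `lit bridges AtomisticToContinuum --cross any`
(30 rows, no CI); `lit galaxy search "compensated integrability" --star all` (galaxyd saturated, no
rows) and `"cluster dynamics" --star all` (12 rows, noise); openalex/s2/arxiv/zbmath rate-limited or
empty (recorded in NOTES). Card + refuter audit reads: arXiv:2002.09157 §1–5, doi:10.5802/crmath.654
pp. 2, 7–8, 17 (re-read this session).
Nearest prior art found: Serre2024 Thm 6 (doi:10.5802/crmath.654) and Serre2021 Thm 1.1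
(doi:10.1007/s00205-021-01610-1) — deterministic worst-case N² payload bounds, the periodic one
under a linear-density hypothesis that fails for the gas at fixed reduced density, typical-data and
pressure questions printed as open (arXiv:2409.12511); Sinai's cluster dynamics (Sinai1972;
DobrushinSinaiSukhov1989) — existence/finiteness of Δ-clusters in equilibrium, no payload;
GabrielovEtAl2008 — numerics  [refs: 10.1007/978-3-031-55260-1_4, 10.1007/bf01028564, 10.4171/057-1/13, 10.5802/crmath.654, 10.1007/s00205-021-01610-1, 2002.09157, 2409.12511, doi:10.1007/978-3-031-55260-1_4, doi:10.1007/bf01028564, doi:10.4171/057-1/13, doi:10.5802/crmath.654, doi:10.1007/s00205-021-01610-1, Sinai1972, DobrushinSinaiSukhov1989, GabrielovEtAl2008, Serre2024, Serre2021]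

Barriers (technique_class: compensated-integrability, dynamical-cluster-statistics): - technique_class: compensated-integrability, dynamical-cluster-statistics
- Literature.Barriers.AtomisticToContinuum.HighMomentumCutoffBarrier: adjacent, not met by the
module — CI bounds COLLISIONAL transfer through conserved cluster energies (E_C^(1/2), E_C), never
exponential velocity moments; the cubic convective energy current is untouched and stays with card
apriori-tails-and-rattlers / crux LargeVelocityControl; PayloadClosure inherits whatever its closure
engine needs.
- Literature.Barriers.AtomisticToContinuum.BoltzmannHypothesisBarrier: the module (cruxes 2–3,
supports) is outside the class (no entropy method, no classification of stationary states); crux 4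
does not evade it by itself — the bet is DissipativeWeakStrong's weak (measure-valued) closure,
which replaces the Boltzmann hypothesis by weak–strong uniqueness before the shock.
- Literature.Barriers.AtomisticToContinuum.NoDensityExpansionBarrier: not met — nothing is expanded
in σ; CI is non-perturbative and σ small enters only through subcriticality of the slab graph (mean
degree ≈ 4√(πθ)ρσ²).
- Literature.Barriers.AtomisticToContinuum.VelocityReversalBarrier: not met — every statement is in
law / in probability under the local Gibbs law, and the payload and cluster functionals are
invariant under time reversal.
- Literature.Barriers.AtomisticToContinuum.DiluteRegimeBarrier: not met — fixed reduced density
(N+1)ε³ = σ³ throughout, no Boltzmann–Grad limit and no kinetic equation.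
- Literature.Barriers.Atomist

History (route lifecycle, newest last):
- 2026-08-16T02:18:25Z · AUTO-CRUX: 1 conjecture-grade item(s) promoted to crux (EquilibriumClusterMoment) — refuter vetting / tiering apply (operator:999:1362873)
- 2026-08-16T23:21:56Z · rev 7: restated PayloadOfClusters (stmt-AtomisticToContinuum-9055), Assembly (stmt-AtomisticToContinuum-9059) — route-repair (p126922) step 1/3: restate PayloadOfClusters with its conclusion CollisionPayloadTight INLINED verbatim (definitionally identical; needed because (planner-rrepair-AtomisticToContinuum-Compensat-ac85c6e4-0)
- 2026-08-16T23:23:32Z · rev 10: dropped L2ToHydroLimit — route-repair (p126922) step 3/3: drop L2ToHydroLimit (the Chebyshev step is now proved inside the crux-only closes, no longer an obligation of this route); thes (planner-rrepair-AtomisticToContinuum-Compensat-ac85c6e4-0)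
- 2026-08-23T23:13:19Z · DORMANT — reconciler: no traction for 6.3 d (last activity item-evidence-added at 2026-08-17T14:48:49Z); parked, not closed — `ledger route dormant route-AtomisticToConti (operator:999:1555411)

sub-problem: HydrodynamicLimit · status: dormant · opened planner-plancard-AtomisticToContinuum-Hydrody-4e619619-0 2026-08-15T13:47:47Z · rev 11 · ledger route-AtomisticToContinuum-CompensatedSlabClusters
GENERATED by the gate from the ledger (D-0016/17). Provers cite these decls: `theorem foo : Summit.AtomisticToContinuum.HydrodynamicLimit.Theses.CompensatedSlabClusters.<Decl> := …` in Summits/AtomisticToContinuum/HydrodynamicLimit/Theorems/<Name>.lean.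
-/

namespace Summit.AtomisticToContinuum.HydrodynamicLimit.Theses.CompensatedSlabClusters

open scoped BigOperators Topology Manifold Classical MeasureTheory ProbabilityTheory Matrix InnerProductSpace ComplexConjugate ContinuousMap
open Filter Set Function TopologicalSpace MeasureTheory

attribute [summit_statement] _root_.HydrodynamicLimit

/-- item stmt-AtomisticToContinuum-9051 · crux · rank 2 · open · by planner
why it might fail: Transcription of Serre2024 Thm 6 to the unit torus: constants (L𝕋³ vs 𝕋³, radius vs diameter), both kinks counted, collisions exactly at a or b, K ≤ 1 edge cases, E = lab-frame configEnergy at time a; a Lean proof means formalising compensated integrability itself (XL).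
sources: Serre2024, Serre2021, Serre2019, doi:10.5802/crmath.654
[crux] SERRE'S PERIODIC PAYLOAD BOUND (imported published fact, filed FIRST per the plancard rule;
card S2's engine): there are universal κ > 0 and c such that for every K, every diameter ε > 0 with
Kε < κ, every hard-sphere trajectory γ of K spheres on 𝕋³ (IsHardSphereTrajectory, torus geometry)
and every a ≤ b, the payload Σ_(collision times t ∈ [a,b]) Σ_i ‖v_i(t) − v_i(t⁻)‖ (right-continuous
velocities, left limits) is ≤ c (K^(3/2) E^(1/2) + (b − a) K E), E = configEnergy (γ a) = ½Σ|v_i|².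
Transcription of Serre2024 Thm 6 / (19)–(20) (Σ_coll |[v]| ≲_d N (NE)^(1/2) + N E T/L under N a <
θ(d) L) to the unit torus, both kinks of a collision counted; the ℝ³ analogue is Serre2021 Thm 1.1
(slab form, §5). To be vendored as a Literature named fact and then consumed as a hypothesis; a Lean
proof needs the CI theory (Serre2019; Serre2024 Thm 3, Thm 11; determinantal masses Serre2021 §4).
[difficulty: XL] -/
@[route_item "route-AtomisticToContinuum-CompensatedSlabClusters", crux]
def SerrePeriodicPayload : Prop :=
  ∃ κ : ℝ, 0 < κ ∧ ∃ c : ℝ, ∀ (K : ℕ) (ε : ℝ), 0 < ε → (K : ℝ) * ε < κ → ∀ γ : ℝ → Literature.Analysis.FluidPDE.Config K (Fin 3) Literature.MathematicalPhysics.KineticTheory.T3, Literature.Analysis.FluidPDE.IsHardSphereTrajectory (Literature.Analysis.FluidPDE.Torus.geometry (Fin 3)) ε K γ → ∀ a b : ℝ, a ≤ b → (∑ᶠ t ∈ Literature.Analysis.FluidPDE.collisionTimes (Literature.Analysis.FluidPDE.Torus.geometry (Fin 3)) ε γ ∩ Set.Icc a b, ∑ i : Fin K, ‖(γ t i).2 -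 (Function.leftLim γ t i).2‖) ≤ c * ((K : ℝ) ^ ((3 : ℝ) / 2) * Real.sqrt (Literature.Analysis.FluidPDE.configEnergy (γ a)) + (b - a) * (K : ℝ) * Literature.Analysis.FluidPDE.configEnergy (γ a))

/-- item stmt-AtomisticToContinuum-9052 · crux · rank 3 · open · by planner
why it might fail: σ₀ is fixed by the initial profiles but the bound is asked ∀T: shock heating/compression or implosive focusing (smooth ideal-gas Euler implosions exist, all γ>1) can push the slab degree 4√(πθ)ρσ² past 1 on a ball with ≥N^(1/5) particles ⇒ giant cluster, ΣK_i⁴ ≥ K⁵ ≫ N; equilibrium case open too.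
sources: GabrielovEtAl2008, Sinai1972, DobrushinSinaiSukhov1989, BuckmasterCaolaboraGomezserrano2025, MerleEtAl2022, CaolaboraEtAl2025
[crux] FOURTH MOMENT OF MOMENTARY CLUSTERS (card S1 folded with its chain counting into one typed
statistic): for all continuous profiles a₀, θ₀ > 0, u₀ there is σ₀ such that for σ < σ₀ and every T
> 0 there is C with: for all N, all flows Φ of N+1 spheres of diameter σ(N+1)^(-1/3), all kinetic
slabs [s, s+τ_N] ⊂ [0,T], τ_N = (N+1)^(-1/3): E_(localGibbsLaw) Σ_i K_i(s)⁴ ≤ C(N+1), where K_i(s)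
is the size of the connected component of i in the slab collision graph (i ~ j iff i, j are in
contact at some t ∈ [s, s+τ_N] along the orbit). Heuristics: mean slab degree ≈ 4√(πθ)ρσ² ≪ 1 for σ
small, so the exploration of a cluster is dominated by a subcritical branching process and all
moments are O(1) per particle; the fourth moment (not the second) is what excludes giant clusters K
≥ κ(N+1)^(1/3)/σ over T(N+1)^(1/3) slabs by a union bound (Σ_i K_i⁴ ≥ K⁵ on a cluster of size K).
[difficulty: open-problem] -/
@[route_item "route-AtomisticToContinuum-CompensatedSlabClusters", crux]
def ClusterFourthMoment : Prop :=
  ∀ (a₀ θ₀ : Literature.MathematicalPhysics.KineticTheory.T3 → ℝ) (u₀ : Literature.MathematicalPhysics.KineticTheory.T3 → Literature.MathematicalPhysics.KineticTheory.V3), Continuous a₀ → Continuous θ₀ → Continuous u₀ → (∀ x, 0 < a₀ x) → (∀ x, 0 < θ₀ x) → ∃ σ₀ : ℝ, 0 < σ₀ ∧ ∀ σ : ℝ, 0 < σ → σ < σ₀ → ∀ T : ℝ, 0 < T → ∃ C : ℝ, 0 < C ∧ ∀ (N : ℕ) (Φ : Literature.Analysis.FluidPDE.HardSphereFlow (Literature.Analysis.FluidPDE.Torus.geometry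 (Fin 3)) (Literature.MathematicalPhysics.KineticTheory.hsDiameter σ N) (N + 1)) (s : ℝ), 0 ≤ s → s + ((N + 1 : ℕ) : ℝ) ^ (-(1 / 3 : ℝ)) ≤ T → let K : Literature.Analysis.FluidPDE.Config (N + 1) (Fin 3) Literature.MathematicalPhysics.KineticTheory.T3 → Fin (N + 1) → ℕ := fun z i => Nat.card {j : Fin (N + 1) // (SimpleGraph.fromRel fun i' j' : Fin (N + 1) => ∃ t ∈ Set.Icc s (s + ((N + 1 : ℕ) : ℝ) ^ (-(1 / 3 : ℝ))), Φ.flow t z ∈ Literature.Analysis.FluidPDE.contactSet (Literature.Analysis.FluidPDE.Torus.geometry (Fin 3)) (N + 1) (Literature.MathematicalPhysics.KineticTheory.hsDiameter σ N) i' j').Reachable i j}; ∫⁻ z, ((∑ i : Fin (N + 1), K z i ^ 4 : ℕ) : ENNReal) ∂(Literature.MathematicalPhysics.KineticTheory.localGibbsLaw σ a₀ u₀ θ₀ N Φ) ≤ ENNReal.ofReal (C * (N + 1))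

/-- item stmt-AtomisticToContinuum-9053 · crux · rank 4 · open · by planner
why it might fail: The closure problem given one a-priori bound: tight collisional flux leaves convective (cubic) energy-flux tails and local equilibrium uncontrolled, limit points may be non-Dirac Young measures with concentration defects, and weak–strong uniqueness needs an entropy inequality (R) does not supply.
sources: BrezinaFeireisl2018, GwiazdaSwierczewskagwiazdaWiedemann2015, arXiv:1503.05246, OllaVaradhanYau1993, Spohn1991
[crux] CLOSURE GIVEN THE A-PRIORI BOUND (the bridge from the module to the conjunct):
CollisionPayloadTight → L2HydroFields, filed SELF-CONTAINED (both Props inlined — definitionally the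
same implication, Iff.rfl — because the gate emits cruxes before the support decls it names). With
the collisional momentum/energy transfer tight, the empirical flux measures on [0,T)×𝕋³ are tight;
the intended proof identifies limit points as dissipative measure-valued hs-Euler solutions and
closes by relative-energy weak–strong uniqueness before the first shock (the
FluxClosure/EntropyAdmissibility/WSU programme of route DissipativeWeakStrong, items 0823–0825), or
by any other closure engine that consumes (R). [deps: CollisionPayloadTight] [difficulty:
open-problem] -/
@[route_item "route-AtomisticToContinuum-CompensatedSlabClusters", crux]
def PayloadClosure : Prop :=
  (∀ (a₀ θ₀ : Literature.MathematicalPhysics.KineticTheory.T3 → ℝ) (u₀ : Literature.MathematicalPhysics.KineticTheory.T3 → Literature.MathematicalPhysics.KineticTheory.V3), Continuous a₀ → Continuous θ₀ → Continuous u₀ → (∀ x, 0 < a₀ x) → (∀ x, 0 < θ₀ x) → ∃ σ₀ : ℝ, 0 < σ₀ ∧ ∀ σ : ℝ, 0 < σ → σ < σ₀ → ∀ T : ℝ, 0 < T → ∀ η : ℝ, 0 < η → ∃ C : ℝ, ∀ (N : ℕ) (Φ : Literature.Analysis.FluidPDE.HardSphereFlow (Literature.Analysis.FluidPDE.Torus.geometry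 (Fin 3)) (Literature.MathematicalPhysics.KineticTheory.hsDiameter σ N) (N + 1)), Literature.MathematicalPhysics.KineticTheory.localGibbsLaw σ a₀ u₀ θ₀ N Φ {z | C * ((N + 1 : ℕ) : ℝ) ^ ((4 : ℝ) / 3) < ∑ᶠ t ∈ Literature.Analysis.FluidPDE.collisionTimes (Literature.Analysis.FluidPDE.Torus.geometry (Fin 3)) (Literature.MathematicalPhysics.KineticTheory.hsDiameter σ N) (fun t' => Φ.flow t' z) ∩ Set.Icc 0 T, ∑ i : Fin (N + 1), ‖(Φ.flow t z i).2 - (Function.leftLim (fun t' => Φ.flow t' z) t i).2‖} ≤ ENNReal.ofReal η) → (∀ (a₀ θ₀ : Literature.MathematicalPhysics.KineticTheory.T3 → ℝ) (u₀ : Literature.MathematicalPhysics.KineticTheory.T3 → Literature.MathematicalPhysics.KineticTheory.V3), Continuous a₀ → Continuous θ₀ → Continuous u₀ → (∀ x, 0 < a₀ x) → (∀ x, 0 < θ₀ x) → ∃ σ₀ : ℝ, 0 < σ₀ ∧ ∀ σ : ℝ, 0 < σ → σ < σ₀ → ∀ (T : ℝ) (ρ θ : ℝ → Literature.MathematicalPhysics.KineticTheory.T3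 → ℝ) (u : ℝ → Literature.MathematicalPhysics.KineticTheory.T3 → Literature.MathematicalPhysics.KineticTheory.V3), Literature.MathematicalPhysics.KineticTheory.IsHardSphereEulerSolution σ T ρ u θ → ∀ Φ : (N : ℕ) → Literature.Analysis.FluidPDE.HardSphereFlow (Literature.Analysis.FluidPDE.Torus.geometry (Fin 3)) (Literature.MathematicalPhysics.KineticTheory.hsDiameter σ N) (N + 1), Literature.MathematicalPhysics.KineticTheory.TendstoHydroFieldsAt (fun N => Literature.MathematicalPhysics.KineticTheory.localGibbsLaw σ a₀ u₀ θ₀ N (Φ N)) Φ ρ u θ 0 → ∀ t ∈ Set.Ico 0 T, ∀ χ : Literature.MathematicalPhysics.KineticTheory.T3 → ℝ, Continuous χ → Filter.Tendsto (fun N : ℕ => ∫⁻ z, ENNReal.ofReal (|Literature.MathematicalPhysics.KineticTheory.empiricalDensityField ((Φ N).flow t z) χ - ∫ x, χ x * ρ t x| ^ 2) ∂(Literature.MathematicalPhysics.KineticTheory.localGibbsLaw σ a₀ u₀ θ₀ N (Φ N))) Filter.atTop (nhds 0) ∧ Filter.Tendsto (fun N : ℕ => ∫⁻ z, ENNReal.ofReal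 (‖Literature.MathematicalPhysics.KineticTheory.empiricalMomentumField ((Φ N).flow t z) χ - ∫ x, (χ x * ρ t x) • u t x‖ ^ 2) ∂(Literature.MathematicalPhysics.KineticTheory.localGibbsLaw σ a₀ u₀ θ₀ N (Φ N))) Filter.atTop (nhds 0) ∧ Filter.Tendsto (fun N : ℕ => ∫⁻ z, ENNReal.ofReal (|Literature.MathematicalPhysics.KineticTheory.empiricalEnergyField ((Φ N).flow t z) χ - ∫ x, χ x * Literature.MathematicalPhysics.KineticTheory.totalEnergyDensity (ρ t x) (u t x) (θ t x)| ^ 2) ∂(Literature.MathematicalPhysics.KineticTheory.localGibbsLaw σ a₀ u₀ θ₀ N (Φ N))) Filter.atTop (nhds 0))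

-- earlier PayloadOfClusters (stmt-AtomisticToContinuum-9055, replaced 2026-08-16T23:21:56Z -> stmt-AtomisticToContinuum-17555): retired by None — SerrePeriodicPayload → ClusterFourthMoment → CollisionPayloadTight
/-- item stmt-AtomisticToContinuum-17555 · crux · rank 9 · open · by planner
why it might fail: a.e. splicing: each momentary cluster's slab piece must extend to a global K-sphere IsHardSphereTrajectory off a null set of the (N+1)-body law (cluster marginals ≪ Liouville_K); collisions at slab endpoints; E_tot=O(N), Σ_k(Σ_i K_i²)^½ only in probability — no slack in the 4/3 exponent.
sources: Serre2024, Alexander1975, GST2013, CIP1994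
[crux] GLUE LEMMA (card S3), since rev 7 a hypothesis of the crux-only `closes` and therefore a crux
until proved: SerrePeriodicPayload → ClusterFourthMoment → CollisionPayloadTight, with the
conclusion CollisionPayloadTight INLINED verbatim (definitionally the same statement, Iff.rfl — the
gate emits cruxes before the support decls they would name, exactly as PayloadClosure inlines it).
Proof plan: (i) for P-a.e. z each connected component A (|A| = K) of the slab graph is isolated
during the slab, and its sub-configuration is a piece of a K-sphere torus trajectory, extendable to
a global IsHardSphereTrajectory for a.e. z (K-particle flows exist:
HardSphereFlow.nonempty_torus_holds; cylinders over Liouville_K-null sets are null; localGibbsLaw ≪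
Liouville); (ii) on the event that all clusters of all slabs [kτ_N,(k+1)τ_N] ⊂ [0,T] have K <
κ(N+1)^(1/3)/σ (probability ≥ 1 − CTσ⁵κ⁻⁵(N+1)^(-1/3) by the fourth moment, Markov and a union
bound) apply the fact cluster-wise: pay(slab) ≤ c[(Σ_i K_i²)^(1/2)(E_tot)^(1/2) + (κ/σ)E_tot]
(Cauchy–Schwarz; clusters of one slab are particle-disjoint; energy conserved); (iii) E_tot ≤
C₂(N+1) with probability ≥ 1 − η/3 (Gaussian velocities of the canon -/
@[route_item "route-AtomisticToContinuum-CompensatedSlabClusters", crux]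
def PayloadOfClusters : Prop :=
  SerrePeriodicPayload → ClusterFourthMoment → ∀ (a₀ θ₀ : Literature.MathematicalPhysics.KineticTheory.T3 → ℝ) (u₀ : Literature.MathematicalPhysics.KineticTheory.T3 → Literature.MathematicalPhysics.KineticTheory.V3), Continuous a₀ → Continuous θ₀ → Continuous u₀ → (∀ x, 0 < a₀ x) → (∀ x, 0 < θ₀ x) → ∃ σ₀ : ℝ, 0 < σ₀ ∧ ∀ σ : ℝ, 0 < σ → σ < σ₀ → ∀ T : ℝ, 0 < T → ∀ η : ℝ, 0 < η → ∃ C : ℝ, ∀ (N : ℕ) (Φ : Literature.Analysis.FluidPDE.HardSphereFlow (Literature.Analysis.FluidPDE.Torus.geometry (Fin 3)) (Literature.MathematicalPhysics.KineticTheory.hsDiameter σ N) (N + 1)), Literature.MathematicalPhysics.KineticTheory.localGibbsLaw σ a₀ u₀ θ₀ N Φ {z | C * ((N + 1 : ℕ) : ℝ) ^ ((4 : ℝ) / 3) < ∑ᶠ t ∈ Literature.Analysis.FluidPDE.collisionTimes (Literature.Analysis.FluidPDE.Torus.geometry (Fin 3)) (Literature.MathematicalPhysics.KineticTheory.hsDiameter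 σ N) (fun t' => Φ.flow t' z) ∩ Set.Icc 0 T, ∑ i : Fin (N + 1), ‖(Φ.flow t z i).2 - (Function.leftLim (fun t' => Φ.flow t' z) t i).2‖} ≤ ENNReal.ofReal η

/-- item stmt-AtomisticToContinuum-9056 · crux (kind.auto-crux: conjecture-grade) · rank 9 · open · by planner
why it might fail: Needs the equilibrium slab contact graph subcritical (mean slab degree ≈ 4√(πθc)ρσ² < 1, i.e. σ < σ₀(c₀,θc)) AND exponential Δ-cluster size tails uniform in N in d=3 — Sinai's cluster finiteness is qualitative; a fat tail P(K ≥ k) ≳ k⁻⁴ already breaks E ΣK_i⁴ = O(N).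
sources: Sinai1972, DobrushinSinaiSukhov1989, GabrielovEtAl2008, Alexander1975
[support] GLOBAL-EQUILIBRIUM CASE of ClusterFourthMoment (constant profiles c₀, uc, θc; the
canonical law is flow-invariant, HomogeneousInvariance item 3073, so the bound is uniform over all
slabs s ∈ ℝ): ∃ σ₀ ∀ σ < σ₀ ∃ C ∀ N Φ s: E Σ_i K_i(s)⁴ ≤ C(N+1). The quantitative form of Sinai's
cluster dynamics (existence and finiteness of Δ-clusters at low density for short windows, Sinai1972
and its multidimensional extension reported in DobrushinSinaiSukhov1989; numerics GabrielovEtAl2008: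
exponential cluster-size law for Δ below t_c ≈ 0.4ρ⁻¹): Palm/GNZ bounds for the canonical
hard-sphere gas plus domination of the slab exploration by a subcritical branching process with
Maxwellian marks. First foothold for provers; the MD check for refuters; the equilibrium half of
card S4 (Serre's printed open problem for Gibbs-typical data then follows with PayloadOfClusters).
[difficulty: L] -/
@[route_item "route-AtomisticToContinuum-CompensatedSlabClusters"]
def EquilibriumClusterMoment : Prop :=
  ∀ (c₀ θc : ℝ) (uc : Literature.MathematicalPhysics.KineticTheory.V3), 0 < c₀ → 0 < θc → ∃ σ₀ : ℝ, 0 < σ₀ ∧ ∀ σ : ℝ, 0 < σ → σ < σ₀ → ∃ C : ℝ, 0 < C ∧ ∀ (N : ℕ) (Φ : Literature.Analysis.FluidPDE.HardSphereFlow (Literature.Analysis.FluidPDE.Torus.geometry (Fin 3)) (Literature.MathematicalPhysics.KineticTheory.hsDiameter σ N) (N + 1)) (s : ℝ), let K : Literature.Analysis.FluidPDE.Config (N + 1) (Fin 3) Literature.MathematicalPhysics.KineticTheory.T3 → Fin (N + 1) → ℕ := fun z i => Nat.card {j : Fin (N + 1) // (SimpleGraph.fromRel fun i' j' : Fin (N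 + 1) => ∃ t ∈ Set.Icc s (s + ((N + 1 : ℕ) : ℝ) ^ (-(1 / 3 : ℝ))), Φ.flow t z ∈ Literature.Analysis.FluidPDE.contactSet (Literature.Analysis.FluidPDE.Torus.geometry (Fin 3)) (N + 1) (Literature.MathematicalPhysics.KineticTheory.hsDiameter σ N) i' j').Reachable i j}; ∫⁻ z, ((∑ i : Fin (N + 1), K z i ^ 4 : ℕ) : ENNReal) ∂(Literature.MathematicalPhysics.KineticTheory.localGibbsLaw σ (fun _ => c₀) (fun _ => uc) (fun _ => θc) N Φ) ≤ ENNReal.ofReal (C * (N + 1))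

/-- item stmt-AtomisticToContinuum-9054 · support · rank 9 · open · by planner
sources: Serre2021, Serre2024, Spohn1991
[support] THE MODULE'S DELIVERABLE (card (R), tightness form; direct proofs welcome at low priority,
otherwise via PayloadOfClusters): for all continuous profiles ∃ σ₀ ∀ σ < σ₀ ∀ T > 0 ∀ η > 0 ∃ C ∀ N
∀ Φ: localGibbsLaw{ z | C (N+1)^(4/3) < Σ_(collision times t ∈ [0,T] of the orbit of z) Σ_i ‖v_i(t)
− v_i(t⁻)‖ } ≤ η. Scale: ≍ 4√(πθ)σ² collisions per particle per slab (N+1)^(-1/3), each exchanging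
O(√θ), over T(N+1)^(1/3) slabs. In probability rather than in mean because on 𝕋³ at fixed reduced
density no deterministic bound makes the payload integrable (Serre2024's linear-density hypothesis
fails for the whole gas). Consumers: FluxClosure tightness half (0823), MeanCollisionalPressureBound
of card apriori-tails-and-rattlers, K-inputs of stiff-relaxation-collisional-coercivity.
[difficulty: open-problem] -/
@[route_item "route-AtomisticToContinuum-CompensatedSlabClusters"]
def CollisionPayloadTight : Prop :=
  ∀ (a₀ θ₀ : Literature.MathematicalPhysics.KineticTheory.T3 → ℝ) (u₀ : Literature.MathematicalPhysics.KineticTheory.T3 → Literature.MathematicalPhysics.KineticTheory.V3), Continuous a₀ → Continuous θ₀ → Continuous u₀ → (∀ x, 0 < a₀ x) → (∀ x, 0 < θ₀ x) → ∃ σ₀ : ℝ, 0 < σ₀ ∧ ∀ σ : ℝ, 0 < σ → σ < σ₀ → ∀ T : ℝ, 0 < T → ∀ η : ℝ, 0 < η → ∃ C : ℝ, ∀ (N : ℕ) (Φ : Literature.Analysis.FluidPDE.HardSphereFlow (Literature.Analysis.FluidPDE.Torus.geometry (Fin 3)) (Literature.MathematicalPhysics.KineticTheory.hsDiameter σ N)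 (N + 1)), Literature.MathematicalPhysics.KineticTheory.localGibbsLaw σ a₀ u₀ θ₀ N Φ {z | C * ((N + 1 : ℕ) : ℝ) ^ ((4 : ℝ) / 3) < ∑ᶠ t ∈ Literature.Analysis.FluidPDE.collisionTimes (Literature.Analysis.FluidPDE.Torus.geometry (Fin 3)) (Literature.MathematicalPhysics.KineticTheory.hsDiameter σ N) (fun t' => Φ.flow t' z) ∩ Set.Icc 0 T, ∑ i : Fin (N + 1), ‖(Φ.flow t z i).2 - (Function.leftLim (fun t' => Φ.flow t' z) t i).2‖} ≤ ENNReal.ofReal η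

/-- item stmt-AtomisticToContinuum-9057 · support · rank 9 · open · by planner
sources: Spohn1991, OllaVaradhanYau1993
[support] SHARED TYPED WAYPOINT (item stmt-AtomisticToContinuum-0800 verbatim; target of routes
DenseKineticExpansion, DissipativeWeakStrong, OneParticleInfluence): mean-square convergence of the
three empirical fields at every t < T under the local Gibbs law; here the codomain of
PayloadClosure. [difficulty: open-problem] -/
@[route_item "route-AtomisticToContinuum-CompensatedSlabClusters"]
def L2HydroFields : Prop :=
  ∀ (a₀ θ₀ : Literature.MathematicalPhysics.KineticTheory.T3 → ℝ) (u₀ : Literature.MathematicalPhysics.KineticTheory.T3 → Literature.MathematicalPhysics.KineticTheory.V3), Continuous a₀ → Continuous θ₀ → Continuous u₀ → (∀ x, 0 < a₀ x) → (∀ x, 0 < θ₀ x) → ∃ σ₀ : ℝ, 0 < σ₀ ∧ ∀ σ : ℝ, 0 < σ → σ < σ₀ → ∀ (T : ℝ) (ρ θ : ℝ → Literature.MathematicalPhysics.KineticTheory.T3 → ℝ) (u : ℝ → Literature.MathematicalPhysics.KineticTheory.T3 → Literature.MathematicalPhysics.KineticTheory.V3), Literature.MathematicalPhysics.KineticTheory.IsHardSphereEulerSolution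 σ T ρ u θ → ∀ Φ : (N : ℕ) → Literature.Analysis.FluidPDE.HardSphereFlow (Literature.Analysis.FluidPDE.Torus.geometry (Fin 3)) (Literature.MathematicalPhysics.KineticTheory.hsDiameter σ N) (N + 1), Literature.MathematicalPhysics.KineticTheory.TendstoHydroFieldsAt (fun N => Literature.MathematicalPhysics.KineticTheory.localGibbsLaw σ a₀ u₀ θ₀ N (Φ N)) Φ ρ u θ 0 → ∀ t ∈ Set.Ico 0 T, ∀ χ : Literature.MathematicalPhysics.KineticTheory.T3 → ℝ, Continuous χ → Filter.Tendsto (fun N : ℕ => ∫⁻ z, ENNReal.ofReal (|Literature.MathematicalPhysics.KineticTheory.empiricalDensityField ((Φ N).flow t z) χ - ∫ x, χ x * ρ t x| ^ 2) ∂(Literature.MathematicalPhysics.KineticTheory.localGibbsLaw σ a₀ u₀ θ₀ N (Φ N))) Filter.atTop (nhds 0) ∧ Filter.Tendsto (fun N : ℕ => ∫⁻ z, ENNReal.ofReal (‖Literature.MathematicalPhysics.KineticTheory.empiricalMomentumField ((Φ N).flow t z) χ - ∫ x, (χ x * ρ t x) • u t x‖ ^ 2) ∂(Literature.MathematicalPhysics.KineticTheory.localGibbsLaw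 σ a₀ u₀ θ₀ N (Φ N))) Filter.atTop (nhds 0) ∧ Filter.Tendsto (fun N : ℕ => ∫⁻ z, ENNReal.ofReal (|Literature.MathematicalPhysics.KineticTheory.empiricalEnergyField ((Φ N).flow t z) χ - ∫ x, χ x * Literature.MathematicalPhysics.KineticTheory.totalEnergyDensity (ρ t x) (u t x) (θ t x)| ^ 2) ∂(Literature.MathematicalPhysics.KineticTheory.localGibbsLaw σ a₀ u₀ θ₀ N (Φ N))) Filter.atTop (nhds 0)

-- earlier Assembly (stmt-AtomisticToContinuum-9059, replaced 2026-08-16T23:21:56Z -> stmt-AtomisticToContinuum-17556): retired by None — SerrePeriodicPayload → ClusterFourthMoment → PayloadOfClusters → PayloadClosure → L2ToHydroLimit → _root_.HydrodynamicLimit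
/-- item stmt-AtomisticToContinuum-17556 · assembly · rank 1 · open · by planner
sources: Serre2021, Spohn1991, OllaVaradhanYau1993
[assembly] SerrePeriodicPayload → ClusterFourthMoment → PayloadOfClusters → PayloadClosure →
HydrodynamicLimit, the sub-problem Statement decl `_root_.HydrodynamicLimit` BY NAME — exactly the
type of the crux-only DECIDING THEOREM `closes` (rev 7, 2026-08-16: the Chebyshev step formerly
assumed as L2ToHydroLimit is proved inside closes; the packing guard of the re-typed conjunct
p126922 is discarded, η₀ := 1). -/
@[route_item "route-AtomisticToContinuum-CompensatedSlabClusters"]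
def Assembly : Prop :=
  SerrePeriodicPayload → ClusterFourthMoment → PayloadOfClusters → PayloadClosure → _root_.HydrodynamicLimit

/-! D-0027 §2.1 — DECIDING THEOREM (planner-authored via `route open/edit --closes-file`; by planner-rbadge-AtomisticToContinuum-Compensate-5b7da47c-0 2026-08-16T23:40:57Z):
its hypotheses are this route's items and its conclusion the sub-problem Statement (glue_lint), and it elaborates with this file. -/

@[closes "route-AtomisticToContinuum-CompensatedSlabClusters"] theorem closes (h₁ : SerrePeriodicPayload) (h₂ : ClusterFourthMoment) (h₃ : PayloadOfClusters)
    (h₄ : PayloadClosure) : _root_.HydrodynamicLimit := by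
  -- MODULE + BRIDGE: Serre's periodic payload bound (h₁) and the fourth moment of momentary
  -- clusters (h₂) give the collisional-payload tightness via the glue h₃; the closure crux h₄ turns
  -- it into mean-square convergence of the three empirical fields (the body of `L2HydroFields`).
  have hL2 := h₄ (h₃ h₁ h₂)
  -- CHEBYSHEV–MARKOV in ℝ≥0∞ (the provable-now step formerly assumed as `L2ToHydroLimit`, now
  -- discharged here): for laws `P N`, measurable real `g N` with `∫⁻ ofReal (g N)² dP N → 0` and
  -- `δ > 0`, `P N {δ < g N} → 0` ({δ < g} ⊆ {δ² ≤ g²} and `meas_ge_le_lintegral_div`).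
  have cheb : ∀ (P : (N : ℕ) → Measure (Literature.Analysis.FluidPDE.Config (N + 1) (Fin 3)
        Literature.MathematicalPhysics.KineticTheory.T3))
      (g : (N : ℕ) → Literature.Analysis.FluidPDE.Config (N + 1) (Fin 3)
        Literature.MathematicalPhysics.KineticTheory.T3 → ℝ),
      (∀ N, Measurable (g N)) →
      Tendsto (fun N => ∫⁻ z, ENNReal.ofReal (g N z ^ 2) ∂P N) atTop (𝓝 0) →
      ∀ δ : ℝ, 0 < δ → Tendsto (fun N => P N {z | δ < g N z}) atTop (𝓝 0) := by
    intro P g hg h δ hδ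
    have hδ2 : ENNReal.ofReal (δ ^ 2) ≠ 0 := by
      rw [Ne, ENNReal.ofReal_eq_zero, not_le]
      positivity
    have hlim : Tendsto (fun N => (∫⁻ z, ENNReal.ofReal (g N z ^ 2) ∂P N) / ENNReal.ofReal (δ ^ 2))
        atTop (𝓝 0) := by
      simpa only [ENNReal.zero_div] using ENNReal.Tendsto.div_const h (Or.inr hδ2)
    refine tendsto_of_tendsto_of_tendsto_of_le_of_le tendsto_const_nhds hlim (fun _ => zero_le)
      fun N => ?_
    calc P N {z | δ < g N z}
        ≤ P N {z | ENNReal.ofReal (δ ^ 2) ≤ ENNReal.ofReal (g N z ^ 2)} := by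
          refine measure_mono fun z hz => ?_
          simp only [mem_setOf_eq] at hz ⊢
          refine ENNReal.ofReal_le_ofReal ?_
          have h0 : 0 ≤ δ := hδ.le
          nlinarith
      _ ≤ (∫⁻ z, ENNReal.ofReal (g N z ^ 2) ∂P N) / ENNReal.ofReal (δ ^ 2) :=
          meas_ge_le_lintegral_div ((hg N).pow_const 2).ennreal_ofReal.aemeasurable hδ2
            ENNReal.ofReal_ne_top
  -- MEASURABILITY of the tested empirical fields (empirical measure = N⁻¹ Σ δ_{z i}).
  have hpos : ∀ {N : ℕ} (i : Fin N), Measurable fun z : Literature.Analysis.FluidPDE.Config N (Fin 3)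
      Literature.MathematicalPhysics.KineticTheory.T3 => (z i).1 :=
    fun i => (measurable_pi_apply i).fst
  have hvel : ∀ {N : ℕ} (i : Fin N), Measurable fun z : Literature.Analysis.FluidPDE.Config N (Fin 3)
      Literature.MathematicalPhysics.KineticTheory.T3 => (z i).2 :=
    fun i => (measurable_pi_apply i).snd
  have hint : ∀ {N : ℕ} {E : Type} [NormedAddCommGroup E] [NormedSpace ℝ E] [CompleteSpace E]
      (F : Literature.MathematicalPhysics.KineticTheory.T3 × Literature.MathematicalPhysics.KineticTheory.V3 → E)
      (z : Literature.Analysis.FluidPDE.Config N (Fin 3) Literature.MathematicalPhysics.KineticTheory.T3),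
      ∫ y, F y ∂Literature.Analysis.FluidPDE.empiricalMeasure z = ((N : ENNReal)⁻¹).toReal • ∑ i, F (z i) := by
    intro N E _ _ _ F z
    rw [Literature.Analysis.FluidPDE.empiricalMeasure_eq, integral_smul_measure,
      integral_finsetSum_measure fun i _ => integrable_dirac enorm_lt_top]
    simp [integral_dirac]
  have mD : ∀ {N : ℕ} {χ : Literature.MathematicalPhysics.KineticTheory.T3 → ℝ}, Continuous χ →
      Measurable fun z : Literature.Analysis.FluidPDE.Config N (Fin 3)
        Literature.MathematicalPhysics.KineticTheory.T3 =>
        Literature.MathematicalPhysics.KineticTheory.empiricalDensityField z χ := by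
    intro N χ hχ
    have : (fun z : Literature.Analysis.FluidPDE.Config N (Fin 3)
        Literature.MathematicalPhysics.KineticTheory.T3 =>
        Literature.MathematicalPhysics.KineticTheory.empiricalDensityField z χ) =
        fun z => ((N : ENNReal)⁻¹).toReal * ∑ i, χ (z i).1 := by
      funext z; exact (hint (fun y => χ y.1) z).trans (smul_eq_mul _ _)
    rw [this]
    exact measurable_const.mul (Finset.measurable_sum _ fun i _ => hχ.measurable.comp (hpos i))
  have mM : ∀ {N : ℕ} {χ : Literature.MathematicalPhysics.KineticTheory.T3 → ℝ}, Continuous χ →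
      Measurable fun z : Literature.Analysis.FluidPDE.Config N (Fin 3)
        Literature.MathematicalPhysics.KineticTheory.T3 =>
        Literature.MathematicalPhysics.KineticTheory.empiricalMomentumField z χ := by
    intro N χ hχ
    have : (fun z : Literature.Analysis.FluidPDE.Config N (Fin 3)
        Literature.MathematicalPhysics.KineticTheory.T3 =>
        Literature.MathematicalPhysics.KineticTheory.empiricalMomentumField z χ) =
        fun z => ((N : ENNReal)⁻¹).toReal • ∑ i, χ (z i).1 • (z i).2 := by
      funext z; exact hint (fun y => χ y.1 • y.2) z
    rw [this]
    exact (Finset.measurable_sum _ fun i _ =>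
      (hχ.measurable.comp (hpos i)).smul (hvel i)).const_smul (((N : ENNReal)⁻¹).toReal)
  have mE : ∀ {N : ℕ} {χ : Literature.MathematicalPhysics.KineticTheory.T3 → ℝ}, Continuous χ →
      Measurable fun z : Literature.Analysis.FluidPDE.Config N (Fin 3)
        Literature.MathematicalPhysics.KineticTheory.T3 =>
        Literature.MathematicalPhysics.KineticTheory.empiricalEnergyField z χ := by
    intro N χ hχ
    have : (fun z : Literature.Analysis.FluidPDE.Config N (Fin 3)
        Literature.MathematicalPhysics.KineticTheory.T3 =>
        Literature.MathematicalPhysics.KineticTheory.empiricalEnergyField z χ) =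
        fun z => ((N : ENNReal)⁻¹).toReal * ∑ i, χ (z i).1 * (‖(z i).2‖ ^ 2 / 2) := by
      funext z; exact (hint (fun y => χ y.1 * (‖y.2‖ ^ 2 / 2)) z).trans (smul_eq_mul _ _)
    rw [this]
    exact measurable_const.mul (Finset.measurable_sum _ fun i _ =>
      (hχ.measurable.comp (hpos i)).mul (((hvel i).norm.pow_const 2).div_const 2))
  -- ASSEMBLY: take η₀ := 1 (the module proves the unguarded limit, so the packing guard is simply
  -- not used), the σ₀ of the mean-square statement, and Chebyshev field by field.
  refine ⟨1, one_pos, fun a₀ θ₀ u₀ ha hθ hu ha0 hθ0 => ?_⟩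
  obtain ⟨σ₀, hσ₀, H⟩ := hL2 a₀ θ₀ u₀ ha hθ hu ha0 hθ0
  refine ⟨σ₀, hσ₀, fun σ hσ hσ' T ρ θ u hsol _hguard Φ h0 t ht => ?_⟩
  intro χ hχ δ hδ
  obtain ⟨c₁, c₂, c₃⟩ := H σ hσ hσ' T ρ θ u hsol Φ h0 t ht χ hχ
  refine ⟨?_, ?_, ?_⟩
  · exact cheb _ (fun N z => |Literature.MathematicalPhysics.KineticTheory.empiricalDensityField
        ((Φ N).flow t z) χ - ∫ x, χ x * ρ t x|)
      (fun N => (((mD hχ).comp ((Φ N).measurable_flow t)).sub_const _).abs) c₁ δ hδ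
  · exact cheb _ (fun N z => ‖Literature.MathematicalPhysics.KineticTheory.empiricalMomentumField
        ((Φ N).flow t z) χ - ∫ x, (χ x * ρ t x) • u t x‖)
      (fun N => (((mM hχ).comp ((Φ N).measurable_flow t)).sub_const _).norm) c₂ δ hδ
  · exact cheb _ (fun N z => |Literature.MathematicalPhysics.KineticTheory.empiricalEnergyField
        ((Φ N).flow t z) χ - ∫ x, χ x *
          Literature.MathematicalPhysics.KineticTheory.totalEnergyDensity (ρ t x) (u t x) (θ t x)|)
      (fun N => (((mE hχ).comp ((Φ N).measurable_flow t)).sub_const _).abs) c₃ δ hδ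

end Summit.AtomisticToContinuum.HydrodynamicLimit.Theses.CompensatedSlabClusters
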